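import Summits.Ventures.PercRepro2.UnionRowPeel
/-!
# The (K) family of the union row for every number of observed vertices: the two-fact identity
(blind cell PercRepro2, mine-1 g42; paper proofs/MINE1-UNIONROW-K3.md §5 and §9, (9.1))

Setting of `UnionRowPeel`: a finite type of cells `ι`, masses `m : ι → ℝ`, a cut set `D`, and the grid row
`rowV m D A B = Σ_{c ∉ D} m c (Z·1_A(c) − M(A)) (Z·1_B(c) − M(B))`.  This file is pure algebra on masses —
no grid, no statuses, no positive association is assumed; the (Z)-positive-association facts enter only as
HYPOTHESES of the last two theorems, in exactly the form the cell's `CondAvoidZPA` gives them on the status grid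
(`M(A)·M(U) ≤ M(A ∩ U)·M(R)` for up-sets `A`, `U` inside an avoidance set `R`, and the mirror for down-sets).

* `rowV_expand`: `V = Z²·M((A∩B)∖D) − Z·M(A)·M(B∖D) − Z·M(B)·M(A∖D) + M(A)·M(B)·M(univ∖D)` (any `A`, `B`).
* `rowV_eq_of_subset` (the identity (9.1) of the paper): for `A ⊆ B`, with `a = M(A)`, `ā = M(A∖D)`, `ν = M((B∖A)∖D)`,
  `γ = M((B∖A)∩D)`, `τ = M(Bᶜ)`, `τ̄ = M(Bᶜ∖D)`:  `V = ā·(ν+γ+τ)·τ − ν·a·τ + τ̄·a·(a+ν+γ)`.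
* `rowV_nonneg_two_facts`: for `A ⊆ B`, two inequalities `a·ν₁ ≤ ā·n₁`, `τ·ν₂ ≤ τ̄·n₂` with `n₁, n₂ ≤ M(B∖A)` and
  `ν ≤ ν₁ + ν₂` force `V ≥ 0` — the organised two-fact (K) identity
  `V = ā τ² + τ̄ a² + τ·(ā n − a ν₁) + a·(τ̄ n − τ ν₂) + a τ·(ν₁ + ν₂ − ν)`, every term nonnegative.
* `rowV_nonneg_of_avoidance_facts`: the same in SET language — an up-fact `M(A)·M(U₁) ≤ M(A∩U₁)·M(R₁)` with
  `A ⊆ R₁ ⊆ B` and `A ∩ U₁` off the cut, the mirror down-fact for `Bᶜ`, and the cover `(B∖A)∖D ⊆ (U₁∖A) ∪ (U₂∖Bᶜ)`.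
  On the three-status grid this is the (K) family (`A = {σ_u = S}`, `B = {σ_u ≠ T}`, `U₁ = R_F`, `R₁ = R_u`, and the
  mirror) for EVERY number of observed vertices, and every principal terminal instance `A = ↑g`, `Bᶜ = ↓h` that has a
  separating coordinate (262 of the 356 at k = 3, paper §9); at k = 3 it specialises to `UnionRowK3Mech.k3_K_two_facts`.
-/

namespace Summit.Ventures.PercRepro2.UnionRowKGen

open Finset
open Summit.Ventures.PercRepro2.UnionRowPeel

variable {ι : Type*} [Fintype ι] [DecidableEq ι]

omit [Fintype ι] in
/-- The indicator of an intersection is the product of the indicators. -/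
theorem ind_inter (A B : Finset ι) (c : ι) : ind (A ∩ B) c = ind A c * ind B c := by
  unfold ind
  by_cases hA : c ∈ A <;> by_cases hB : c ∈ B <;> simp [hA, hB]

omit [Fintype ι] in
/-- Subadditivity of the mass (nonnegative `m`). -/
theorem mass_union_le {m : ι → ℝ} (hm : ∀ x, 0 ≤ m x) (S T : Finset ι) :
    mass m (S ∪ T) ≤ mass m S + mass m T := by
  have h := sum_union_inter (s₁ := S) (s₂ := T) (f := m)
  have h0 := mass_nonneg hm (S ∩ T)
  unfold mass at *
  linarith

/-- The row expanded in masses: `V = Z²·M((A∩B)∖D) − Z·M(A)·M(B∖D) − Z·M(B)·M(A∖D) + M(A)·M(B)·M(univ∖D)`. -/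
theorem rowV_expand (m : ι → ℝ) (D A B : Finset ι) :
    rowV m D A B
      = mass m univ ^ 2 * mass m ((A ∩ B) \ D) - mass m univ * mass m A * mass m (B \ D)
        - mass m univ * mass m B * mass m (A \ D) + mass m A * mass m B * mass m (univ \ D) := by
  have hpt : ∀ c ∈ univ \ D,
      m c * (mass m univ * ind A c - mass m A) * (mass m univ * ind B c - mass m B)
        = mass m univ ^ 2 * (m c * ind (A ∩ B) c) - mass m univ * mass m A * (m c * ind B c)
          - mass m univ * mass m B * (m c * ind A c) + mass m A * mass m B * m c := by
    intro c _
    rw [ind_inter]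
    ring
  unfold rowV
  rw [sum_congr rfl hpt]
  simp only [sum_add_distrib, sum_sub_distrib, ← mul_sum, sum_ind_sdiff]
  rfl

/-- The (K) identity (9.1): for `A ⊆ B`, with `a = M(A)`, `ā = M(A∖D)`, `ν = M((B∖A)∖D)`, `γ = M((B∖A)∩D)`,
`τ = M(Bᶜ)`, `τ̄ = M(Bᶜ∖D)`:  `V = ā·(ν+γ+τ)·τ − ν·a·τ + τ̄·a·(a+ν+γ)`. -/
theorem rowV_eq_of_subset (m : ι → ℝ) (D A B : Finset ι) (hAB : A ⊆ B) :
    rowV m D A B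
      = mass m (A \ D) * (mass m ((B \ A) \ D) + mass m ((B \ A) ∩ D) + mass m (univ \ B)) * mass m (univ \ B)
        - mass m ((B \ A) \ D) * mass m A * mass m (univ \ B)
        + mass m ((univ \ B) \ D) * mass m A * (mass m A + mass m ((B \ A) \ D) + mass m ((B \ A) ∩ D)) := by
  rw [rowV_expand, inter_eq_left.2 hAB]
  -- the mass relations
  have hb : mass m B = mass m A + mass m (B \ A) := by
    have := mass_sdiff_add m hAB; linarith
  have hZ : mass m univ = mass m B + mass m (univ \ B) := by
    have := mass_sdiff_add m (subset_univ B); linarith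
  have hn : mass m (B \ A) = mass m ((B \ A) \ D) + mass m ((B \ A) ∩ D) := by
    have := mass_sdiff_add m (inter_subset_left (s₁ := B \ A) (s₂ := D))
    rw [sdiff_inter_self_left] at this; linarith
  have hBD : mass m (B \ D) = mass m (A \ D) + mass m ((B \ A) \ D) := by
    have hsub : A \ D ⊆ B \ D := sdiff_subset_sdiff hAB le_rfl
    have := mass_sdiff_add m hsub
    have heq : (B \ D) \ (A \ D) = (B \ A) \ D := by
      ext c; simp only [mem_sdiff]; tauto
    rw [heq] at this; linarith
  have hUD : mass m (univ \ D) = mass m (B \ D) + mass m ((univ \ B) \ D) := by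
    have hsub : B \ D ⊆ univ \ D := sdiff_subset_sdiff (subset_univ B) le_rfl
    have := mass_sdiff_add m hsub
    have heq : (univ \ D) \ (B \ D) = (univ \ B) \ D := by
      ext c; simp only [mem_sdiff, mem_univ, true_and]; tauto
    rw [heq] at this; linarith
  rw [hUD, hBD, hZ, hb, hn]
  ring

/-- The organised two-fact (K) identity: for `A ⊆ B` and reals `ν₁, ν₂, n₁, n₂` with
`a·ν₁ ≤ ā·n₁`, `τ·ν₂ ≤ τ̄·n₂`, `n₁, n₂ ≤ M(B∖A)` and `M((B∖A)∖D) ≤ ν₁ + ν₂`, the row is nonnegative: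
`V = ā τ² + τ̄ a² + τ·(ā n − a ν₁) + a·(τ̄ n − τ ν₂) + a τ·(ν₁ + ν₂ − ν)`, every term `≥ 0`. -/
theorem rowV_nonneg_two_facts {m : ι → ℝ} (hm : ∀ x, 0 ≤ m x) (D A B : Finset ι) (hAB : A ⊆ B)
    {ν₁ ν₂ n₁ n₂ : ℝ}
    (h1 : mass m A * ν₁ ≤ mass m (A \ D) * n₁)
    (h2 : mass m (univ \ B) * ν₂ ≤ mass m ((univ \ B) \ D) * n₂)
    (hn₁ : n₁ ≤ mass m (B \ A)) (hn₂ : n₂ ≤ mass m (B \ A))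
    (hcover : mass m ((B \ A) \ D) ≤ ν₁ + ν₂) :
    0 ≤ rowV m D A B := by
  have ha := mass_nonneg hm A
  have hAbar := mass_nonneg hm (A \ D)
  have hτ := mass_nonneg hm (univ \ B)
  have hTbar := mass_nonneg hm ((univ \ B) \ D)
  have hn : mass m (B \ A) = mass m ((B \ A) \ D) + mass m ((B \ A) ∩ D) := by
    have := mass_sdiff_add m (inter_subset_left (s₁ := B \ A) (s₂ := D))
    rw [sdiff_inter_self_left] at this; linarith
  have key : rowV m D A B
      = mass m (A \ D) * mass m (univ \ B) ^ 2 + mass m ((univ \ B) \ D) * mass m A ^ 2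
        + mass m (univ \ B) * (mass m (A \ D) * mass m (B \ A) - mass m A * ν₁)
        + mass m A * (mass m ((univ \ B) \ D) * mass m (B \ A) - mass m (univ \ B) * ν₂)
        + mass m A * mass m (univ \ B) * (ν₁ + ν₂ - mass m ((B \ A) \ D)) := by
    rw [rowV_eq_of_subset m D A B hAB, hn]
    ring
  have s1 : 0 ≤ mass m (A \ D) * mass m (B \ A) - mass m A * ν₁ := by
    have := mul_le_mul_of_nonneg_left hn₁ hAbar; linarith
  have s2 : 0 ≤ mass m ((univ \ B) \ D) * mass m (B \ A) - mass m (univ \ B) * ν₂ := by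
    have := mul_le_mul_of_nonneg_left hn₂ hTbar; linarith
  have t1 := mul_nonneg hAbar (mul_nonneg hτ hτ)
  have t2 := mul_nonneg hTbar (mul_nonneg ha ha)
  have t3 := mul_nonneg hτ s1
  have t4 := mul_nonneg ha s2
  have t5 := mul_nonneg (mul_nonneg ha hτ) (sub_nonneg.2 hcover)
  rw [key]
  nlinarith [t1, t2, t3, t4, t5]

/-- The (K) family from two avoidance facts, in set language.  `A ⊆ B`; an UP-fact `M(A)·M(U₁) ≤ M(A∩U₁)·M(R₁)`
whose avoidance set `R₁` contains `A` and misses `Bᶜ` and whose second set `U₁` meets `A` off the cut; the mirror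
DOWN-fact `M(Bᶜ)·M(U₂) ≤ M(Bᶜ∩U₂)·M(R₂)` with `Bᶜ ⊆ R₂`, `R₂ ∩ A = ∅`, `Bᶜ ∩ U₂` off the cut; and the cover
`(B∖A)∖D ⊆ (U₁∖A) ∪ (U₂∖Bᶜ)`.  Then the row is nonnegative. -/
theorem rowV_nonneg_of_avoidance_facts {m : ι → ℝ} (hm : ∀ x, 0 ≤ m x) (D A B U₁ R₁ U₂ R₂ : Finset ι)
    (hAB : A ⊆ B)
    (hAR₁ : A ⊆ R₁) (hR₁B : R₁ ⊆ B) (hU₁ : Disjoint (A ∩ U₁) D)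
    (hF1 : mass m A * mass m U₁ ≤ mass m (A ∩ U₁) * mass m R₁)
    (hBR₂ : univ \ B ⊆ R₂) (hR₂A : Disjoint R₂ A) (hU₂ : Disjoint ((univ \ B) ∩ U₂) D)
    (hF2 : mass m (univ \ B) * mass m U₂ ≤ mass m ((univ \ B) ∩ U₂) * mass m R₂)
    (hcover : (B \ A) \ D ⊆ (U₁ \ A) ∪ (U₂ \ (univ \ B))) :
    0 ≤ rowV m D A B := by
  have ha := mass_nonneg hm A
  have hτ := mass_nonneg hm (univ \ B)
  have hn₁0 := mass_nonneg hm (R₁ \ A)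
  have hn₂0 := mass_nonneg hm (R₂ \ (univ \ B))
  -- the up-fact in the two-fact form: a·M(U₁∖A) ≤ ā·M(R₁∖A)
  have hU₁' : mass m U₁ = mass m (A ∩ U₁) + mass m (U₁ \ A) := by
    have := mass_sdiff_add m (inter_subset_right (s₁ := A) (s₂ := U₁))
    have heq : U₁ \ (A ∩ U₁) = U₁ \ A := by ext c; simp only [mem_sdiff, mem_inter]; tauto
    rw [heq] at this; linarith
  have hR₁' : mass m R₁ = mass m A + mass m (R₁ \ A) := by
    have := mass_sdiff_add m hAR₁; linarith
  have hAU₁ : mass m (A ∩ U₁) ≤ mass m (A \ D) := by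
    apply mass_mono hm
    intro c hc
    rw [mem_sdiff]
    refine ⟨(mem_inter.1 hc).1, fun hcD => ?_⟩
    exact (Finset.disjoint_left.1 hU₁) hc hcD
  have h1 : mass m A * mass m (U₁ \ A) ≤ mass m (A \ D) * mass m (R₁ \ A) := by
    rw [hU₁', hR₁'] at hF1
    have := mul_le_mul_of_nonneg_right hAU₁ hn₁0
    nlinarith
  -- the down-fact: τ·M(U₂∖Bᶜ) ≤ τ̄·M(R₂∖Bᶜ)
  have hU₂' : mass m U₂ = mass m ((univ \ B) ∩ U₂) + mass m (U₂ \ (univ \ B)) := by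
    have := mass_sdiff_add m (inter_subset_right (s₁ := univ \ B) (s₂ := U₂))
    have heq : U₂ \ ((univ \ B) ∩ U₂) = U₂ \ (univ \ B) := by
      ext c; simp only [mem_sdiff, mem_inter, mem_univ, true_and]; tauto
    rw [heq] at this; linarith
  have hR₂' : mass m R₂ = mass m (univ \ B) + mass m (R₂ \ (univ \ B)) := by
    have := mass_sdiff_add m hBR₂; linarith
  have hBU₂ : mass m ((univ \ B) ∩ U₂) ≤ mass m ((univ \ B) \ D) := by
    apply mass_mono hm
    intro c hc
    rw [mem_sdiff]
    refine ⟨(mem_inter.1 hc).1, fun hcD => ?_⟩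
    exact (Finset.disjoint_left.1 hU₂) hc hcD
  have h2 : mass m (univ \ B) * mass m (U₂ \ (univ \ B))
      ≤ mass m ((univ \ B) \ D) * mass m (R₂ \ (univ \ B)) := by
    rw [hU₂', hR₂'] at hF2
    have := mul_le_mul_of_nonneg_right hBU₂ hn₂0
    nlinarith
  -- the two avoidance sets miss the other side: n₁, n₂ ≤ M(B∖A)
  have hn₁ : mass m (R₁ \ A) ≤ mass m (B \ A) := mass_mono hm (sdiff_subset_sdiff hR₁B le_rfl)
  have hn₂ : mass m (R₂ \ (univ \ B)) ≤ mass m (B \ A) := by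
    apply mass_mono hm
    intro c hc
    rw [mem_sdiff] at hc ⊢
    refine ⟨?_, fun hcA => (Finset.disjoint_left.1 hR₂A) hc.1 hcA⟩
    by_contra hcB
    exact hc.2 (mem_sdiff.2 ⟨mem_univ c, hcB⟩)
  -- the cover
  have hcov : mass m ((B \ A) \ D) ≤ mass m (U₁ \ A) + mass m (U₂ \ (univ \ B)) :=
    (mass_mono hm hcover).trans (mass_union_le hm _ _)
  exact rowV_nonneg_two_facts hm D A B hAB h1 h2 hn₁ hn₂ hcov

end Summit.Ventures.PercRepro2.UnionRowKGen
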